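import Literature.NumberTheory.NumberFields.RayClassFieldTwoVariableDecomposition
import HarnessLib

/-!
# LIFTABILITY IS DECIDED ON THE BOTTOM LAYER `K(𝔤v')`: `IsLocArtinLiftable 𝔤 v v' 𝔞 ↔ (𝔞, K(𝔤v')/K) ∈ D_v`, and the
# principal ideals `(α)`, `α ≡ 1 mod 𝔤v'`, `v ∤ α`, are liftable (de Shalit II.4.12: the indices `𝔞₁ = (α₁)`; II.1.10)

Sequel of `RayClassFieldTwoVariableDecomposition.lean` (same setting and hypotheses: `K` totally complex, `v' ≠ v`, `v ∤ 𝔤 ≠ 0`,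
`w_{𝔤v'} = 1`, uniformiser `π`, `α_i = π^{f_i} ≡ 1 mod 𝔤v'^{i+1}`, local unramified tower `E_j` with offset `c`, `hdegE`, INERT from
level `0`, COUNT).  There the index set `IsLocArtinLiftable 𝔤 v v' 𝔞` of the (c)-capstone (integral `𝔞 ≠ 0` prime to `𝔤vv'` whose
Artin symbol at EVERY diagonal level `K(𝔤v'^{n+1}v^{n+1})` is the restriction of a local element along `ι : K̄ → K̄_v`) was shown
to meet every local class.  THIS file shows that the infinitely many level conditions collapse to ONE condition on the bottom layer
— the decomposition group of `𝔓` in `Gal(K(𝔤v'^∞v^∞)/K)` is open with base `K(𝔤v')` — and exhibits the principal indices: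

* ★★ `isLocArtinLiftable_of_bot` / `isLocArtinLiftable_iff_bot` — `𝔞` is liftable iff `(𝔞, K(𝔤v')/K) = res τ₀|` for some
  `τ₀ ∈ Γ_{K_v}` (`τ₀⁻¹g_𝔞` fixes `K(𝔤v')` and acts on the `v`-tower as a local inertia element — `𝔓` totally ramified —
  then (SURJ) of the prequel on each `K(𝔤v'^{n+1}v^{n+1})`);
* `isLocArtinLiftable_of_artinSymbol_eq_one` — trivial Artin symbol on `K(𝔤v')` suffices;
* ★★ `isLocArtinLiftable_span_singleton` — **`(α)` with `α ≡ 1 mod 𝔤v'`, `v ∤ α`, is liftable** (`(α) ∈ P^{𝔤v'}`: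
  `RayClassFieldAdicCharacterPrincipal.mem_ker_of_forall_absRestrictNormalHom_eq_artinHom`) — de Shalit's `𝔞₁ = (α₁)` of the
  division step II.4.12 (`κ(σ_{(α)}) = α_v⁻¹`) lies in the index set of the (c)-capstone.

Theorems only; no `sorry`; no definitions.

## References
* [deShalit1987] E. de Shalit, *Iwasawa theory of elliptic curves with complex multiplication* (1987), II.1.10 Corollary (p. 39),
  II.4.12 (p. 66–68), II.4.17 (p. 78).
* [NeukirchANT1999] J. Neukirch, *Algebraic Number Theory* (1999), Ch. VI §5 Prop. (5.6), §7 Thm. (7.1).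
-/

noncomputable section

open NumberField IsDedekindDomain IsDedekindDomain.HeightOneSpectrum Field
open scoped nonZeroDivisors Classical

namespace Literature.NumberTheory.NumberFields

open Literature.NumberTheory.GaloisRepresentations
open Literature.NumberTheory.GaloisRepresentations.IsNonarchimedeanLocalField
open Literature.NumberTheory.LFunctions.AbelianDensity (artinSymbol)
open ValuativeRel

variable {K : Type} [Field K] [NumberField K] {𝔤 : Ideal (𝓞 K)} {v v' : HeightOneSpectrum (𝓞 K)}

/-! ### §0. Restrictions and moduli (bookkeeping, as in the prequel) -/

omit [NumberField K] in
/-- `((τ|_L) x : K̄) = τ • x`. [folklore] -/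
private theorem coe_absRestrictNormalHom_apply₁₆ (L : IntermediateField K (AlgebraicClosure K)) [Normal K L]
    (τ : absoluteGaloisGroup K) (x : L) :
    ((absRestrictNormalHom L τ x : L) : AlgebraicClosure K) = τ • (x : AlgebraicClosure K) :=
  AlgEquiv.restrictNormalHom_apply L _ x

omit [NumberField K] in
/-- `res_L ρ = res_L ρ'` iff `ρ`, `ρ'` agree on `L` pointwise. [folklore] -/
private theorem absRestrictNormalHom_eq_iff_forall_smul_eq₁₆ (L : IntermediateField K (AlgebraicClosure K)) [Normal K L]
    (ρ ρ' : absoluteGaloisGroup K) :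
    absRestrictNormalHom L ρ = absRestrictNormalHom L ρ' ↔ ∀ x ∈ L, ρ • x = ρ' • x := by
  constructor
  · intro h x hx
    have e := congrArg (fun σ : L ≃ₐ[K] L ↦ ((σ ⟨x, hx⟩ : L) : AlgebraicClosure K)) h
    simpa only [coe_absRestrictNormalHom_apply₁₆] using e
  · intro h
    ext x
    rw [coe_absRestrictNormalHom_apply₁₆, coe_absRestrictNormalHom_apply₁₆]
    exact h x x.2

omit [NumberField K] in
/-- Agreement on `L'` restricts to agreement on `L ≤ L'`. [folklore] -/
private theorem absRestrictNormalHom_eq_of_le₁₆ {L L' : IntermediateField K (AlgebraicClosure K)} [Normal K L] [Normal K L']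
    (hLL' : L ≤ L') {ρ ρ' : absoluteGaloisGroup K} (h : absRestrictNormalHom L' ρ = absRestrictNormalHom L' ρ') :
    absRestrictNormalHom L ρ = absRestrictNormalHom L ρ' :=
  (absRestrictNormalHom_eq_iff_forall_smul_eq₁₆ L ρ ρ').mpr fun x hx ↦
    (absRestrictNormalHom_eq_iff_forall_smul_eq₁₆ L' ρ ρ').mp h x (hLL' hx)

omit [NumberField K] in
/-- `𝔤v'^{i+1}v^{k} ≠ 0`. [cite: deShalit1987, II.4.14 (p. 71)] -/
private theorem moduli₂_ne_bot₁₆ (h𝔤0 : 𝔤 ≠ ⊥) (i k : ℕ) : 𝔤 * v'.asIdeal ^ (i + 1) * v.asIdeal ^ k ≠ ⊥ :=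
  mul_ne_zero (mul_ne_zero h𝔤0 (pow_ne_zero _ v'.ne_bot)) (pow_ne_zero _ v.ne_bot)

/-- `v ∤ 𝔤v'^{i+1}`. [cite: deShalit1987, II.4.14 (p. 71)] -/
private theorem not_moduli_le₁₆ (hv : ¬ 𝔤 ≤ v.asIdeal) (hvv' : v' ≠ v) (i : ℕ) : ¬ 𝔤 * v'.asIdeal ^ (i + 1) ≤ v.asIdeal := by
  intro h
  rcases (v.isPrime.mul_le).mp h with h1 | h2
  · exact hv h1
  · exact hvv' (HeightOneSpectrum.ext ((v'.isMaximal.eq_of_le v.isPrime.ne_top ((Ideal.IsPrime.pow_le_iff (hP := v.isPrime)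
      (Nat.succ_ne_zero i)).mp h2))))

variable [IsTotallyComplex K]
  (h𝔤0 : 𝔤 ≠ ⊥) (hv : ¬ 𝔤 ≤ v.asIdeal) (hvv' : v' ≠ v) (hw : ∀ u : (𝓞 K)ˣ, (u : 𝓞 K) - 1 ∈ 𝔤 * v'.asIdeal → u = 1)
  {π : 𝒪[v.adicCompletion K]} (hπ : (valuation (v.adicCompletion K)).IsUniformizer (π : v.adicCompletion K))
  {α : ℕ → 𝓞 K} (hα0 : ∀ i, α i ≠ 0) (hα𝔪 : ∀ i, α i - 1 ∈ 𝔤 * v'.asIdeal ^ (i + 1))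
  (hαw : ∀ i, ∀ w : HeightOneSpectrum (𝓞 K), w ≠ v → α i ∉ w.asIdeal)
  {f : ℕ → ℕ} (hαπ : ∀ i, ((α i : K) : v.adicCompletion K) = (π : v.adicCompletion K) ^ f i)
  (E : ℕ → IntermediateField (v.adicCompletion K) (AlgebraicClosure (v.adicCompletion K)))
  [∀ j, FiniteDimensional (v.adicCompletion K) (E j)] [∀ j, IsGalois (v.adicCompletion K) (E j)]
  (hmono : Monotone E) (hE : ∀ j, E j ≤ maxUnramified (v.adicCompletion K)) (c : ℕ)
  (hdegE : ∀ i, ∀ w : WeilGroup (v.adicCompletion K),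
    WeilGroup.toAbsGalois (v.adicCompletion K) w ∈ (E (i + c)).fixingSubgroup → (f i : ℤ) ∣ WeilGroup.deg w)
  (hinert : ∀ i, ∀ τ : absoluteGaloisGroup (v.adicCompletion K),
    (∀ y ∈ rayClassField K (𝔤 * v'.asIdeal ^ (i + 1)),
      τ • absClosureEmbedding K (v.adicCompletion K) y = absClosureEmbedding K (v.adicCompletion K) y) →
      τ ∈ (E (i + c)).fixingSubgroup)
  (hcount : ∀ i k : ℕ, IntermediateField.relfinrank (rayClassField K (𝔤 * v'.asIdeal ^ (i + 1) * v.asIdeal ^ (k + 1)))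
      (rayClassField K (𝔤 * v'.asIdeal ^ (i + 1 + 1) * v.asIdeal ^ (k + 1))) * Module.finrank (v.adicCompletion K) (E (i + c)) ≤
      Module.finrank (v.adicCompletion K) (E (i + 1 + c)))

/-! ### §1. Liftability is decided on the bottom layer `K(𝔤v')` -/

include h𝔤0 hv hvv' hw hπ hα0 hα𝔪 hαw hαπ hmono hE hdegE hinert hcount in
/-- ★★ **Liftable at every level iff liftable on `K(𝔤v')`**: an integral ideal `𝔞 ≠ 0` prime to `𝔤vv'` is `IsLocArtinLiftable` as soon
as its Artin symbol on the BOTTOM layer `K(𝔤v')` is the restriction of a local element `τ₀ ∈ Γ_{K_v}` — i.e. `(𝔞, K(𝔤v')/K)` lies in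
the decomposition group of `v` in `K(𝔤v')/K` (generated by the Frobenius).  (`τ₀⁻¹g_𝔞` fixes `K(𝔤v')`, so acts on the `v`-tower
`K(𝔤v'v^∞)` as a local inertia element `w`; `(τ₀w)⁻¹g_𝔞` fixes `K(𝔤v'v^{n+1})`, and §3 supplies a local partner on `K(𝔤v'^{n+1}v^{n+1})`.)
So de Shalit's `D`-condition is ONE condition at the bottom of the tower: the decomposition group is open.
[cite: deShalit1987, II.1.10 Corollary (p. 39), II.4.12 (p. 66–68)] [cite: NeukirchANT1999, Ch. VI §5 Prop. (5.6), §7 Thm. (7.1)] -/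
theorem isLocArtinLiftable_of_bot {𝔞 : Ideal (𝓞 K)} (h𝔞0 : 𝔞 ≠ ⊥) (h𝔞c : IsCoprime 𝔞 (𝔤 * v.asIdeal * v'.asIdeal))
    (τ₀ : absoluteGaloisGroup (v.adicCompletion K))
    (hτ₀ : absRestrictNormalHom (rayClassField K (𝔤 * v'.asIdeal)) (absGaloisRestrict K (v.adicCompletion K) τ₀) =
      artinSymbol (galFrob K (rayClassField K (𝔤 * v'.asIdeal))) 𝔞) :
    IsLocArtinLiftable 𝔤 v v' 𝔞 := by
  have ha := isLocalArtinMap_canonicalArtin_holds (v.adicCompletion K)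
  have h𝔪0 : 𝔤 * v'.asIdeal ≠ ⊥ := mul_ne_zero h𝔤0 v'.ne_bot
  have h𝔪v : ¬ 𝔤 * v'.asIdeal ≤ v.asIdeal := fun h ↦ not_moduli_le₁₆ hv hvv' 0 (by rwa [zero_add, pow_one])
  have hcopn : ∀ i k : ℕ, IsCoprime 𝔞 (𝔤 * v'.asIdeal ^ (i + 1) * v.asIdeal ^ k) := fun i k ↦
    ((h𝔞c.of_mul_right_left.of_mul_right_left).mul_right (h𝔞c.of_mul_right_right.pow_right)).mul_right
      (h𝔞c.of_mul_right_left.of_mul_right_right.pow_right)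
  -- the global Artin element of `𝔞`
  obtain ⟨g, hg⟩ := exists_forall_absRestrictNormalHom_eq_artinHom (K := K)
    (Units.mk0 (𝔞 : FractionalIdeal (𝓞 K)⁰ K) (coeIdeal_ne_zero_of_ne_bot h𝔞0))
  have hg' : ∀ i k : ℕ, absRestrictNormalHom (rayClassField K (𝔤 * v'.asIdeal ^ (i + 1) * v.asIdeal ^ k)) g =
      artinSymbol (galFrob K (rayClassField K (𝔤 * v'.asIdeal ^ (i + 1) * v.asIdeal ^ k))) 𝔞 := fun i k ↦ by
    rw [hg _ (moduli₂_ne_bot₁₆ h𝔤0 i k) (unitsMk0_coeIdeal_mem_idealsPrimeTo (moduli₂_ne_bot₁₆ h𝔤0 i k) h𝔞0 (hcopn i k)),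
      artinHom_unitsMk0_coeIdeal _ h𝔞0]
  have hg₀ : absRestrictNormalHom (rayClassField K (𝔤 * v'.asIdeal)) g = artinSymbol (galFrob K (rayClassField K (𝔤 * v'.asIdeal))) 𝔞 := by
    rw [hg _ h𝔪0 (unitsMk0_coeIdeal_mem_idealsPrimeTo h𝔪0 h𝔞0 (h𝔞c.of_mul_right_left.of_mul_right_left.mul_right h𝔞c.of_mul_right_right)),
      artinHom_unitsMk0_coeIdeal _ h𝔞0]
  -- `τ₀⁻¹ g` fixes `K(𝔤v')`: an inertia partner `w` on the `v`-tower `K(𝔤v'v^k)`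
  have hker : (absGaloisRestrict K (v.adicCompletion K) τ₀)⁻¹ * g ∈ (absRestrictNormalHom (rayClassField K (𝔤 * v'.asIdeal))).ker := by
    rw [MonoidHom.mem_ker, map_mul, map_inv, inv_mul_eq_one, hτ₀, hg₀]
  obtain ⟨w, -, -, hw'⟩ := exists_mem_inertia_forall_absRestrictNormalHom_eq h𝔪0 h𝔪v hw ha ⟨_, hker⟩
  refine ⟨h𝔞0, h𝔞c, fun n ↦ ?_⟩
  -- `(τ₀ w)⁻¹ g` fixes `K(𝔤v'^{0+1}v^{n+1}) = K(𝔤v'v^{n+1})` pointwise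
  have hle : rayClassField K (𝔤 * v'.asIdeal ^ (0 + 1) * v.asIdeal ^ (n + 1)) ≤ rayClassField K (𝔤 * v'.asIdeal * v.asIdeal ^ (n + 1)) :=
    rayClassField_le_of_le (mul_ne_zero h𝔪0 (pow_ne_zero _ v.ne_bot)) (by rw [zero_add, pow_one])
  have hfix : ∀ y ∈ rayClassField K (𝔤 * v'.asIdeal ^ (0 + 1) * v.asIdeal ^ (n + 1)),
      ((absGaloisRestrict K (v.adicCompletion K) (τ₀ * WeilGroup.toAbsGalois (v.adicCompletion K) w))⁻¹ * g) • y = y := by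
    have e : absRestrictNormalHom (rayClassField K (𝔤 * v'.asIdeal * v.asIdeal ^ (n + 1)))
        ((absGaloisRestrict K (v.adicCompletion K) (τ₀ * WeilGroup.toAbsGalois (v.adicCompletion K) w))⁻¹ * g) =
        absRestrictNormalHom (rayClassField K (𝔤 * v'.asIdeal * v.asIdeal ^ (n + 1))) 1 := by
      have h1 := hw' (n + 1)
      simp only [map_mul, map_inv, map_one] at h1 ⊢
      rw [h1]
      group
    intro y hy
    have h1 := (absRestrictNormalHom_eq_iff_forall_smul_eq₁₆ _ _ _).mp (absRestrictNormalHom_eq_of_le₁₆ hle e) y hy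
    rwa [one_smul] at h1
  obtain ⟨τ', hτ'⟩ := exists_local_forall_absRestrictNormalHom_rayClassField₂_eq h𝔤0 hv hvv' hw hπ hα0 hα𝔪 hαw hαπ E hmono hE c
    hdegE hinert hcount n (Nat.zero_le n) _ hfix
  refine ⟨τ₀ * WeilGroup.toAbsGalois (v.adicCompletion K) w * τ', ?_⟩
  rw [map_mul, map_mul, hτ' (n + 1)]
  simp only [map_mul, map_inv]
  rw [mul_inv_cancel_left, hg' n (n + 1)]

include h𝔤0 hv hvv' hw hπ hα0 hα𝔪 hαw hαπ hmono hE hdegE hinert hcount in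
/-- **Liftable iff liftable on `K(𝔤v')`.** [cite: deShalit1987, II.4.12 (p. 66–68)] [cite: NeukirchANT1999, Ch. VI §5 Prop. (5.6)] -/
theorem isLocArtinLiftable_iff_bot (𝔞 : Ideal (𝓞 K)) :
    IsLocArtinLiftable 𝔤 v v' 𝔞 ↔ 𝔞 ≠ ⊥ ∧ IsCoprime 𝔞 (𝔤 * v.asIdeal * v'.asIdeal) ∧
      ∃ τ₀ : absoluteGaloisGroup (v.adicCompletion K),
        absRestrictNormalHom (rayClassField K (𝔤 * v'.asIdeal)) (absGaloisRestrict K (v.adicCompletion K) τ₀) =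
          artinSymbol (galFrob K (rayClassField K (𝔤 * v'.asIdeal))) 𝔞 := by
  constructor
  · rintro ⟨h𝔞0, h𝔞c, hl⟩
    refine ⟨h𝔞0, h𝔞c, ?_⟩
    obtain ⟨τ', hτ'⟩ := hl 0
    -- restrict the level-`0` identity from `K(𝔤v'v)` to `K(𝔤v')` through the global Artin element
    have h𝔪0 : 𝔤 * v'.asIdeal ≠ ⊥ := mul_ne_zero h𝔤0 v'.ne_bot
    obtain ⟨g, hg⟩ := exists_forall_absRestrictNormalHom_eq_artinHom (K := K)
      (Units.mk0 (𝔞 : FractionalIdeal (𝓞 K)⁰ K) (coeIdeal_ne_zero_of_ne_bot h𝔞0))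
    have hcop0 : IsCoprime 𝔞 (𝔤 * v'.asIdeal ^ ((0 : ℕ) + 1) * v.asIdeal ^ ((0 : ℕ) + 1)) :=
      ((h𝔞c.of_mul_right_left.of_mul_right_left).mul_right (h𝔞c.of_mul_right_right.pow_right)).mul_right
        (h𝔞c.of_mul_right_left.of_mul_right_right.pow_right)
    have hg0 : absRestrictNormalHom (rayClassField K (𝔤 * v'.asIdeal ^ ((0 : ℕ) + 1) * v.asIdeal ^ ((0 : ℕ) + 1))) g =
        artinSymbol (galFrob K (rayClassField K (𝔤 * v'.asIdeal ^ ((0 : ℕ) + 1) * v.asIdeal ^ ((0 : ℕ) + 1)))) 𝔞 := by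
      rw [hg _ (moduli₂_ne_bot₁₆ h𝔤0 0 (0 + 1)) (unitsMk0_coeIdeal_mem_idealsPrimeTo (moduli₂_ne_bot₁₆ h𝔤0 0 (0 + 1)) h𝔞0 hcop0),
        artinHom_unitsMk0_coeIdeal _ h𝔞0]
    have hg₀ : absRestrictNormalHom (rayClassField K (𝔤 * v'.asIdeal)) g = artinSymbol (galFrob K (rayClassField K (𝔤 * v'.asIdeal))) 𝔞 := by
      rw [hg _ h𝔪0 (unitsMk0_coeIdeal_mem_idealsPrimeTo h𝔪0 h𝔞0 (h𝔞c.of_mul_right_left.of_mul_right_left.mul_right h𝔞c.of_mul_right_right)),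
        artinHom_unitsMk0_coeIdeal _ h𝔞0]
    have hle : rayClassField K (𝔤 * v'.asIdeal) ≤ rayClassField K (𝔤 * v'.asIdeal ^ ((0 : ℕ) + 1) * v.asIdeal ^ ((0 : ℕ) + 1)) :=
      rayClassField_le_of_le (moduli₂_ne_bot₁₆ h𝔤0 0 (0 + 1)) (by rw [zero_add, pow_one, pow_one]; exact Ideal.mul_le_right)
    exact ⟨τ', (absRestrictNormalHom_eq_of_le₁₆ hle (hτ'.trans hg0.symm)).trans hg₀⟩
  · rintro ⟨h𝔞0, h𝔞c, τ₀, hτ₀⟩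
    exact isLocArtinLiftable_of_bot h𝔤0 hv hvv' hw hπ hα0 hα𝔪 hαw hαπ E hmono hE c hdegE hinert hcount h𝔞0 h𝔞c τ₀ hτ₀

include h𝔤0 hv hvv' hw hπ hα0 hα𝔪 hαw hαπ hmono hE hdegE hinert hcount in
/-- **Ideals with trivial Artin symbol on `K(𝔤v')` are liftable** (`τ₀ = 1`). [cite: deShalit1987, II.4.12 (p. 66–68)] -/
theorem isLocArtinLiftable_of_artinSymbol_eq_one {𝔞 : Ideal (𝓞 K)} (h𝔞0 : 𝔞 ≠ ⊥) (h𝔞c : IsCoprime 𝔞 (𝔤 * v.asIdeal * v'.asIdeal))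
    (h1 : artinSymbol (galFrob K (rayClassField K (𝔤 * v'.asIdeal))) 𝔞 = 1) : IsLocArtinLiftable 𝔤 v v' 𝔞 :=
  isLocArtinLiftable_of_bot h𝔤0 hv hvv' hw hπ hα0 hα𝔪 hαw hαπ E hmono hE c hdegE hinert hcount h𝔞0 h𝔞c 1 (by rw [map_one, map_one, h1])

omit [IsTotallyComplex K] in
/-- `(α)` as a unit of fractional ideals: `toPrincipalIdeal (α) = mk0 ↑(span {α})`. [folklore] -/
private theorem toPrincipalIdeal_mk0_eq_unitsMk0_coeIdeal_span₁₆ {α : 𝓞 K} (hα0 : α ≠ 0) :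
    toPrincipalIdeal (𝓞 K) K (Units.mk0 (α : K) (by exact_mod_cast hα0)) =
      Units.mk0 ((Ideal.span {α} : Ideal (𝓞 K)) : FractionalIdeal (𝓞 K)⁰ K)
        (coeIdeal_ne_zero_of_ne_bot (by rwa [Ne, Ideal.span_singleton_eq_bot])) := by
  ext1
  rw [coe_toPrincipalIdeal, Units.val_mk0, Units.val_mk0, FractionalIdeal.coeIdeal_span_singleton]

include h𝔤0 hv hvv' hw hπ hα0 hα𝔪 hαw hαπ hmono hE hdegE hinert hcount in
/-- ★★ **Principal ideals `(α)` with `α ≡ 1 mod 𝔤v'`, `v ∤ α`, are liftable** — their Artin symbol is trivial on `K(𝔤v')`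
(`(α) ∈ P^{𝔤v'}`; `RayClassFieldAdicCharacterPrincipal.mem_ker_of_forall_absRestrictNormalHom_eq_artinHom`).  These are the indices
`𝔞₁ = (α₁)` of de Shalit's division step II.4.12 (with `κ(σ_{(α)}) = α_v⁻¹`), now available INSIDE the index set of the (c)-capstone.
[cite: deShalit1987, II.4.12 (p. 66–68), II.4.17 (p. 78)] [cite: NeukirchANT1999, Ch. VI §7 Thm. (7.1)] -/
theorem isLocArtinLiftable_span_singleton {a : 𝓞 K} (ha0 : a ≠ 0) (ha𝔪 : a - 1 ∈ 𝔤 * v'.asIdeal) (hav : a ∉ v.asIdeal) :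
    IsLocArtinLiftable 𝔤 v v' (Ideal.span {a}) := by
  have h𝔪0 : 𝔤 * v'.asIdeal ≠ ⊥ := mul_ne_zero h𝔤0 v'.ne_bot
  have h𝔪v : ¬ 𝔤 * v'.asIdeal ≤ v.asIdeal := fun h ↦ not_moduli_le₁₆ hv hvv' 0 (by rwa [zero_add, pow_one])
  have hs0 : Ideal.span {a} ≠ ⊥ := by rwa [Ne, Ideal.span_singleton_eq_bot]
  -- `(a)` is prime to `𝔤vv'`: `(a) + 𝔤v' = 1` and `a ∉ v`
  have hsup : IsCoprime (Ideal.span {a}) (𝔤 * v'.asIdeal) := by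
    rw [Ideal.isCoprime_iff_exists]
    exact ⟨a, Ideal.mem_span_singleton_self a, -(a - 1), neg_mem ha𝔪, by ring⟩
  have hcv : IsCoprime (Ideal.span {a}) v.asIdeal := by
    rw [Ideal.isCoprime_iff_sup_eq]
    refine v.isMaximal.out.2 _ (lt_of_le_of_ne le_sup_right fun h ↦ hav ?_)
    rw [h]
    exact Ideal.mem_sup_left (Ideal.mem_span_singleton_self a)
  have hcop : IsCoprime (Ideal.span {a}) (𝔤 * v.asIdeal * v'.asIdeal) :=
    (hsup.of_mul_right_left.mul_right hcv).mul_right hsup.of_mul_right_right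
  -- the Artin symbol of `(a)` is trivial on `K(𝔤v')`
  obtain ⟨σ, hσ⟩ := exists_forall_absRestrictNormalHom_eq_artinHom_span_singleton h𝔪0 h𝔪v ha0 ha𝔪 hav
  have hker := mem_ker_of_forall_absRestrictNormalHom_eq_artinHom h𝔪0 h𝔪v ha0 ha𝔪 hav hσ
  have h0 := hσ 0
  rw [pow_zero, mul_one] at h0
  refine isLocArtinLiftable_of_artinSymbol_eq_one h𝔤0 hv hvv' hw hπ hα0 hα𝔪 hαw hαπ E hmono hE c hdegE hinert hcount hs0 hcop ?_
  rw [← artinHom_unitsMk0_coeIdeal _ hs0, ← toPrincipalIdeal_mk0_eq_unitsMk0_coeIdeal_span₁₆ ha0, ← h0]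
  exact (MonoidHom.mem_ker).mp hker


end Literature.NumberTheory.NumberFields

end
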